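import Literature.AlgebraicGeometry.HodgeTheory.HodgeGroupProductSemisimpleCMFactor
import Literature.AlgebraicGeometry.Milne1999.CodesHCOfCMHodgeHypothesis
import HarnessLib

/-!
# Hodge classes on `A × C`, `C` of CM type — VI: CM factors of Weil type with DISCRIMINANT 1 (Floccari–Fu 2026): the `dim C = 4` product cells on which the hypothesis HC_CM is ABSENT because its instance at `C` — and at every power `C^(k+1)` — is a THEOREM in print; factors of powers; per-cell exactness `HC(A × C^(k+1)) ⟺ HC(A)`

Family `hodge`, layer `Literature/AlgebraicGeometry/HodgeTheory`. Written for the cell `pub-hodge-ring2`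
(route seat `motiv`, generation 5: Mumford–Tate groups / Hodge-ring generation), serving the ATLAS of
complex abelian varieties of dimension `≤ 7` (one row per endomorphism/Mumford–Tate cell, with a KIND
column LOAD-BEARING / ABSENT / DISCHARGED / IS-THE-HYPOTHESIS for the hypothesis HC_CM). HONEST FRAMING:
research route conditional on HC_CM; not a corollary; Q11.4-sentence-2 already refuted in dim ≥ 3. (No
statement minted inside this programme is cited as a fact. This part introduces NO new named fact: its
only inputs are the tree's refereed facts `FloccariFu2026_hodgeClasses_algebraic_powers_discOneWeilFourfold`
(Floccari–Fu, J. Math. Pures Appl. 210 (2026) 103876, Theorem 1.2: "The Hodge conjecture holds for all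
powers of any abelian fourfold of Weil type with discriminant 1" — print's definition of "Weil type",
p. 3 of the held text arXiv:2504.13607, is `ℚ(√-d) ⊆ End⁰` acting with multiplicities `(n,n)`, with NO
genericity condition, and the proof of Theorem 1.2 (ibid. §4, "Proof of Theorem 1.2") starts from an
arbitrary such fourfold `B`; so CM members of the discriminant-1 families are covered by print as stated),
`Gordon1999_hodgeClassesProductSpan_of_semisimple` and `Lombardo2016_hodgeClassesProductSpan` (the
splitting `Hg(A × C) = Hg(A) × Hg(C)` for `Hg(A)` semisimple, resp. `A` without type-IV factor, and `C`
of CM type), all as HYPOTHESES.)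

HC_CM := "the Hodge conjecture for every complex abelian variety of CM type", always the BINDER
`(hCM : ∀ B, Milne1999.CMHodgeHypothesisAt B)`; its instance at one `C` is `Milne1999.CMHodgeHypothesisAt C`.
NOWHERE in this file is HC_CM or any instance of it a hypothesis: the point of the part is that on the
cells below the instance is DISCHARGED.

## The class, on the tree's carriers

`IsDiscOneWeilFourfold C` — `C` is a complex abelian FOURFOLD (`C.dim = 2 * 2`) carrying `φ : C ⟶ C` with
`φ ≫ φ = -(d • 𝟙 C)` for some integer `d ≥ 1` (`K = ℚ(√-d) ↪ End⁰ C`), a projective embedding `ι` and a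
rational class `a ≠ 0` on `H²(ℙᴺ(ℂ); ℂ)` such that `(C, φ)` is of HYPERBOLIC Weil type for the
`K`-symmetrised hyperplane class `h = d·ι^*a + φ^*ι^*a` — literally the hypothesis list of the Floccari–Fu
fact, packaged as ONE predicate so that atlas cells can quantify over it
(`floccariFu_iff_forall_isDiscOneWeilFourfold`: the fact IS "HC for every power of every member of the
class", so the predicate is faithful to the typed fact by a kernel-checked `Iff`). Hyperbolic for `n = 2`
`⟺` discriminant `(-1)² det H = 1` (dictionary (3) of `Motives/HyperbolicWeilType`; van Geemen LNM 1594
Lemma 5.2); hyperbolic ⟹ `K` acts with multiplicities `(2,2)`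
(`Motives.finrank_eigenspace_inf_hodgeOneZero_eq_of_isHyperbolicWeilType`). The predicate does NOT say
`C` is of CM type and does NOT say `Hg(C)` is semisimple: the class contains the general member
(`Hg = SU(2,2)`), Moonen–Zarhin's case (a) `Y₃ × E_k` (neither CM nor semisimple), and CM members.

## What this part proves (KERNEL; every HC_CM-instance DISCHARGED, no claim, no HC_CM)

* THE CLASS ITSELF and its powers: `hodgeConjectureFor_of_isDiscOneWeilFourfold` (HC(`C`)),
  `hodgeConjectureFor_powSucc_of_isDiscOneWeilFourfold` (HC(`C^(k+1)`)), isogeny closure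
  `hodgeConjectureFor_of_isIsogenous_powSucc_of_isDiscOneWeilFourfold`, and FACTORS OF POWERS
  `hodgeConjectureFor_of_prod_isIsogenous_powSucc_of_isDiscOneWeilFourfold` (`X × Y ~ C^(k+1) ⟹ HC(X)`:
  e.g. `E_k² × C₃′ × …` inside `(E_k × C₃′)²` — the sub-products of powers of one discriminant-1 fourfold).
* HC_CM DISCHARGED on the class: `cmHodgeHypothesisAt_of_isDiscOneWeilFourfold`,
  `cmHodgeHypothesisAt_powSucc_of_isDiscOneWeilFourfold`, `cmHodgeHypothesisAt_of_isIsogenous_powSucc_…` —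
  Milne's hypothesis at `C`, at `C^(k+1)` and at anything isogenous to a power holds OUTRIGHT (modulo the
  Floccari–Fu fact), whether or not `C` is of CM type.
* PRODUCT CELLS, KIND = ABSENT: for `A` with semisimple Hodge group (Gordon binder `hG`) or without
  type-IV factor (Lombardo binder `hL`) and `C` of CM type in the class,
  `HC(A) ⟹ HC(A × C)` and `HC(A) ⟹ HC(A × C^(k+1))`
  (`hodgeConjectureFor_prod_of_semisimple_of_cm_isDiscOneWeilFourfold`, `…_prod_powSucc_…`,
  `…_of_lombardo_…`), closed OUTRIGHT when `dim A ≤ 3` (`…_of_dim_le_three_…`: cells of dimension `≤ 7`,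
  e.g. a threefold with `Hg` semisimple times a CM fourfold of discriminant-1 Weil type) or when `A` is
  itself a discriminant-1 Weil fourfold with semisimple Hodge group (`…_of_isDiscOneWeilFourfold_both`,
  dimension 8); isogeny closure `hodgeConjectureFor_of_isIsogenous_prod_…`.
* PER-CELL EXACTNESS: `hodgeConjectureFor_prod_powSucc_iff_left_of_semisimple_of_cm_isDiscOneWeilFourfold` —
  `HC(A × C^(k+1)) ⟺ HC(A)`: such a cell is worth exactly HC of its non-CM part; HC_CM contributes nothing.
* `isOfCMType_powSucc` — powers of a CM abelian variety are CM (Milne 1999 §2 p. 54; by `IsOfCMType.prod`).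
* ON PATH: every target follows from the Hodge conjecture for all smooth projective varieties
  (`…_of_hodgeConjecture` lemmas at the end; Part III's `hodgeConjectureFor_of_hodgeConjecture'`).

## Print-level placement of the class among CM fourfolds (docstring only; nothing of this is asserted in Lean)

By Moonen–Zarhin (Duke Math. J. 77 (1995) for simple fourfolds; Compositio 114 (1999) Thm. (0.1) for all
fourfolds), the rational Hodge ring of a complex abelian fourfold `X` is generated by divisor classes
unless some imaginary quadratic `k ⊆ End⁰(X)` acts with multiplicities `(2,2)`, in which case the extra
generators are the Weil classes `W_k`. For a CM fourfold `C` this leaves exactly Moonen–Zarhin's CM cases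
— (a)-CM `E_k × C₃′` (`C₃′` a simple CM threefold whose sextic CM field contains `k`) and (b)-CM (simple,
CM field of degree 8 containing `k` with multiplicities `(2,2)`) — as the CM fourfolds on which HC is not
the Lefschetz (1,1) theorem; each comes with discriminants `δ_k ∈ ℚ^×_{>0}/Nm(k^×)`. THIS PART covers
those with SOME `δ_k = 1` (witnessed on the carriers by `IsDiscOneWeilFourfold C`); for (a)-CM products
`E_k × C₃′` a product polarization `λ·L_E ⊞ L_{C₃′}` (`λ ∈ ℚ_{>0}`) has `det H = λ · det H_E · det H_{C₃′}`,
so `λ` can be chosen with `det H ∈ Nm(k^×)` — a READING recorded in the cell's map (RING2-MAP §atlas-1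
A1.4, §motiv gen 5), to be re-derived by the atlas's second implementation, NOT a kernel statement (the
hyperbolicity witness stays a binder here). CM fourfolds all of whose `(2,2)`-subfields have `δ_k ≠ 1`
are NOT covered: there the instance `Milne1999.CMHodgeHypothesisAt C` remains LOAD-BEARING (Part IV
`hodgeConjectureFor_prod_iff_cmHodgeHypothesisAt_of_semisimple`), known in print only sporadically
(Schoen 1988 for `k = ℚ(√-3)`; see Floccari–Fu p. 3) and claimed in general only in Markman's unrefereed
2025 preprint (the tree's CLAIM binder `Markman2025_weilClasses_algebraic_abelianFourfold`).

Presearch (both corpora, 2026-08-19): "Hodge conjecture powers CM abelian fourfold Weil type discriminant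
one product" — [corpus:paper:arxiv-2504.13607 p0003 L21–22, p0012 L8–11] (Theorem 1.2 and its proof for an
arbitrary member); [corpus:paper:arxiv-2509.23403 p21] (Markman's survey citing [FF]); no text found
stating the product rows `HC(A × C^(k+1)) ⟺ HC(A)` for `C` CM of discriminant-1 Weil type (queries
"product abelian variety CM factor Weil type discriminant 1 Hodge conjecture", galaxy
"discriminant 1|Weil type fourfold|powers of abelian fourfold" --star all: hits are [FF], Markman, van
Geemen LNM 1594 only).
-/

noncomputable section

open CategoryTheory

namespace Literature.AlgebraicGeometry.HodgeTheory

open Literature.AlgebraicTopology.SingularHomology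

/-! ### The class predicate: abelian fourfolds of Weil type with discriminant 1, in the Floccari–Fu binder shape -/

/-- **Abelian fourfold of Weil type with discriminant 1** on the tree's carriers, literally the hypothesis
list of `FloccariFu2026_hodgeClasses_algebraic_powers_discOneWeilFourfold`: `C.dim = 4`; an endomorphism
`φ` with `φ² = -d` (`d ≥ 1`, so `ℚ(√-d) ↪ End⁰ C`); a projective embedding `e` and a rational class
`a ≠ 0` on `H²` of the ambient projective space such that `(C, φ)` is of hyperbolic Weil type (`n = 2`:
discriminant `1`) for the `ℚ(√-d)`-symmetrised hyperplane class `d·e.ι^*a + φ^*e.ι^*a`.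
[cite: FloccariFu2026, Theorem 1.2 (p. 3: definition of Weil type; discriminant)] -/
def IsDiscOneWeilFourfold (C : Motives.AbelianVariety ℂ) : Prop :=
  C.dim = 2 * 2 ∧
    ∃ (d : ℕ) (_ : 0 < d) (φ : C ⟶ C) (_ : φ ≫ φ = -(d • 𝟙 C)) (e : Motives.ProjectiveEmbedding C.X)
      (a : complexBetti (Motives.projectiveSpace e.n ℂ) 2),
      IsRationalClass a ∧ a ≠ 0 ∧
        Motives.IsHyperbolicWeilType C φ 2
          ((d : ℂ) • complexBetti.map e.ι 2 a + complexBetti.map φ.hom.hom.hom 2 (complexBetti.map e.ι 2 a))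

/-- The binders of the Floccari–Fu fact assemble to membership in the class. [folklore] -/
theorem isDiscOneWeilFourfold_of_binders {d : ℕ} (hd : 0 < d) (C : Motives.AbelianVariety ℂ)
    (φ : C ⟶ C) (hC : C.dim = 2 * 2) (hφ : φ ≫ φ = -(d • 𝟙 C)) (e : Motives.ProjectiveEmbedding C.X)
    (a : complexBetti (Motives.projectiveSpace e.n ℂ) 2) (ha : IsRationalClass a) (ha0 : a ≠ 0)
    (hyp : Motives.IsHyperbolicWeilType C φ 2
      ((d : ℂ) • complexBetti.map e.ι 2 a + complexBetti.map φ.hom.hom.hom 2 (complexBetti.map e.ι 2 a))) :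
    IsDiscOneWeilFourfold C :=
  ⟨hC, d, hd, φ, hφ, e, a, ha, ha0, hyp⟩

/-- A member of the class is a fourfold. [folklore] -/
theorem IsDiscOneWeilFourfold.dim_eq {C : Motives.AbelianVariety ℂ} (hC : IsDiscOneWeilFourfold C) :
    C.dim = 4 :=
  hC.1

/-! ### HC for the class and all its powers (Floccari–Fu 2026, Theorem 1.2) -/

/-- **HC for every power `C^(k+1)` of a discriminant-1 Weil fourfold** — the Floccari–Fu fact read on the
class predicate (full summit-layer predicate, via the tree's `hodgeConjectureFor_powSucc_of_floccariFu`).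
[cite: FloccariFu2026, Theorem 1.2] -/
theorem hodgeConjectureFor_powSucc_of_isDiscOneWeilFourfold
    (h5 : FloccariFu2026_hodgeClasses_algebraic_powers_discOneWeilFourfold) (C : Motives.AbelianVariety ℂ)
    (hC : IsDiscOneWeilFourfold C) (k : ℕ) :
    HodgeConjectureFor (C.powSucc k).dim (C.powSucc k).X := by
  obtain ⟨hC4, d, hd, φ, hφ, e, a, ha, ha0, hyp⟩ := hC
  exact hodgeConjectureFor_powSucc_of_floccariFu h5 hd C φ hC4 hφ e a ha ha0 hyp k

/-- **HC for a discriminant-1 Weil fourfold itself** (`k = 0`, `C.powSucc 0 = C`); in particular Markman's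
refereed 2023 theorem on its Weil classes. [cite: FloccariFu2026, Theorem 1.2]
[cite: Markman2023GeneralizedKummers, Theorem 1.5 (= Theorem 13.4), p. 236; pre-v4 arXiv text: Theorem 1.3] -/
theorem hodgeConjectureFor_of_isDiscOneWeilFourfold
    (h5 : FloccariFu2026_hodgeClasses_algebraic_powers_discOneWeilFourfold) (C : Motives.AbelianVariety ℂ)
    (hC : IsDiscOneWeilFourfold C) : HodgeConjectureFor C.dim C.X :=
  hodgeConjectureFor_powSucc_of_isDiscOneWeilFourfold h5 C hC 0

/-- **Faithfulness of the predicate**: the Floccari–Fu fact is EQUIVALENT to "the Hodge conjecture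
(summit-layer predicate) for every power of every member of the class `IsDiscOneWeilFourfold`" — the
Hodge-model conjunct being the tree's theorem `nonempty_hodgeModel_holds`. [cite: FloccariFu2026, Theorem 1.2] -/
theorem floccariFu_iff_forall_isDiscOneWeilFourfold :
    FloccariFu2026_hodgeClasses_algebraic_powers_discOneWeilFourfold ↔
      ∀ C : Motives.AbelianVariety ℂ, IsDiscOneWeilFourfold C →
        ∀ k : ℕ, HodgeConjectureFor (C.powSucc k).dim (C.powSucc k).X :=
  ⟨fun h5 C hC k ↦ hodgeConjectureFor_powSucc_of_isDiscOneWeilFourfold h5 C hC k,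
    fun h _ hd C φ hC hφ e a ha ha0 hyp k p c hc hpp ↦
      (h C (isDiscOneWeilFourfold_of_binders hd C φ hC hφ e a ha ha0 hyp) k).2 p c hc hpp⟩

/-- **Isogeny closure of the powers**: `X ~ C^(k+1)` ⟹ HC(`X`). [cite: vanGeemen1994HodgeAV, §3.7 Lemma 3.7 (p. 236)]
[cite: FloccariFu2026, Theorem 1.2] -/
theorem hodgeConjectureFor_of_isIsogenous_powSucc_of_isDiscOneWeilFourfold
    (h5 : FloccariFu2026_hodgeClasses_algebraic_powers_discOneWeilFourfold) {X : Motives.AbelianVariety ℂ}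
    (C : Motives.AbelianVariety ℂ) (hC : IsDiscOneWeilFourfold C) (k : ℕ)
    (hX : Motives.AbelianVariety.IsIsogenous X (C.powSucc k)) : HodgeConjectureFor X.dim X.X :=
  HodgeConjectureFor.of_isIsogenous hX (hodgeConjectureFor_powSucc_of_isDiscOneWeilFourfold h5 C hC k)

/-- **Factors of powers**: if `X × Y` is isogenous to a power `C^(k+1)` of a discriminant-1 Weil fourfold,
then HC(`X`) — restriction to the slice `X × {0}` (Part II's `hodgeConjectureFor_left_of_prod`). This is
the row for the sub-products of powers of ONE member, e.g. `E_k² × C₃′` or `E_k × C₃′²` inside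
`(E_k × C₃′)²`. [cite: FloccariFu2026, Theorem 1.2] [cite: vanGeemen1994HodgeAV, §3.7 Lemma 3.7 (p. 236)] -/
theorem hodgeConjectureFor_of_prod_isIsogenous_powSucc_of_isDiscOneWeilFourfold
    (h5 : FloccariFu2026_hodgeClasses_algebraic_powers_discOneWeilFourfold)
    (X Y C : Motives.AbelianVariety ℂ) (hC : IsDiscOneWeilFourfold C) (k : ℕ)
    (hXY : Motives.AbelianVariety.IsIsogenous (X.prod Y) (C.powSucc k)) : HodgeConjectureFor X.dim X.X :=
  hodgeConjectureFor_left_of_prod X Y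
    (hodgeConjectureFor_of_isIsogenous_powSucc_of_isDiscOneWeilFourfold h5 C hC k hXY)

/-! ### Powers of a CM abelian variety are CM -/

/-- **`C` of CM type ⟹ `C^(k+1)` of CM type** (Milne 1999 p. 54: products of CM abelian varieties are CM;
`Milne1999.IsOfCMType.prod`, by induction on `k`). [cite: Milne1999, §2 p. 54] -/
theorem isOfCMType_powSucc {C : Motives.AbelianVariety ℂ} (hCt : Milne1999.IsOfCMType C) :
    ∀ k : ℕ, Milne1999.IsOfCMType (C.powSucc k)
  | 0 => hCt
  | k + 1 => Milne1999.IsOfCMType.prod (isOfCMType_powSucc hCt k) hCt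

/-! ### HC_CM DISCHARGED on the class: Milne's hypothesis at `C`, at `C^(k+1)`, and up to isogeny -/

/-- **The instance of HC_CM at a discriminant-1 Weil fourfold is a theorem** (modulo the Floccari–Fu fact):
`Milne1999.CMHodgeHypothesisAt C` holds outright — whether or not `C` is of CM type (if it is not, the
hypothesis is vacuous anyway; if it is, this DISCHARGES the atlas's CM cells of (a)-CM / (b)-CM type with
discriminant 1). [cite: FloccariFu2026, Theorem 1.2] [cite: Milne1999, §7 p. 72] -/
theorem cmHodgeHypothesisAt_of_isDiscOneWeilFourfold
    (h5 : FloccariFu2026_hodgeClasses_algebraic_powers_discOneWeilFourfold) (C : Motives.AbelianVariety ℂ)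
    (hC : IsDiscOneWeilFourfold C) : Milne1999.CMHodgeHypothesisAt C :=
  fun _ _ ↦ hodgeConjectureFor_of_isDiscOneWeilFourfold h5 C hC

/-- **… and at every power `C^(k+1)`** (CM abelian varieties of dimension `4(k+1)`: `8, 12, …` — far outside
the dimension-`≤ 5` floor). [cite: FloccariFu2026, Theorem 1.2] [cite: Milne1999, §7 p. 72] -/
theorem cmHodgeHypothesisAt_powSucc_of_isDiscOneWeilFourfold
    (h5 : FloccariFu2026_hodgeClasses_algebraic_powers_discOneWeilFourfold) (C : Motives.AbelianVariety ℂ)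
    (hC : IsDiscOneWeilFourfold C) (k : ℕ) : Milne1999.CMHodgeHypothesisAt (C.powSucc k) :=
  fun _ _ ↦ hodgeConjectureFor_powSucc_of_isDiscOneWeilFourfold h5 C hC k

/-- **… and at anything isogenous to a power** (the atlas cells are isogeny classes).
[cite: FloccariFu2026, Theorem 1.2] [cite: vanGeemen1994HodgeAV, §3.7 Lemma 3.7 (p. 236)] -/
theorem cmHodgeHypothesisAt_of_isIsogenous_powSucc_of_isDiscOneWeilFourfold
    (h5 : FloccariFu2026_hodgeClasses_algebraic_powers_discOneWeilFourfold) {X : Motives.AbelianVariety ℂ}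
    (C : Motives.AbelianVariety ℂ) (hC : IsDiscOneWeilFourfold C) (k : ℕ)
    (hX : Motives.AbelianVariety.IsIsogenous X (C.powSucc k)) : Milne1999.CMHodgeHypothesisAt X :=
  fun _ _ ↦ hodgeConjectureFor_of_isIsogenous_powSucc_of_isDiscOneWeilFourfold h5 C hC k hX

/-! ### PRODUCT CELLS `A × C`, `A × C^(k+1)` with `C` of CM type in the class — KIND = ABSENT -/

/-- **`Hg(A)` semisimple, `C` CM of discriminant-1 Weil type: `HC(A) ⟹ HC(A × C)` — no HC_CM.** The Hodge
classes of `A × C` are spanned by products (splitting fact), HC(`A`) is the hypothesis, HC(`C`) is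
Floccari–Fu. [cite: Gordon1999HodgeAVSurvey, §3 proof of the Theorem (last step)]
[cite: FloccariFu2026, Theorem 1.2] -/
theorem hodgeConjectureFor_prod_of_semisimple_of_cm_isDiscOneWeilFourfold
    (h5 : FloccariFu2026_hodgeClasses_algebraic_powers_discOneWeilFourfold)
    (hG : Gordon1999_hodgeClassesProductSpan_of_semisimple) (A C : Motives.AbelianVariety ℂ)
    (hA : HasSemisimpleHodgeGroup A) (hCt : Milne1999.IsOfCMType C) (hC : IsDiscOneWeilFourfold C)
    (hHA : HodgeConjectureFor A.dim A.X) : HodgeConjectureFor (A.prod C).dim (A.prod C).X :=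
  hodgeConjectureFor_prod_of_productSpan A C (hG A C hA hCt) hHA
    (hodgeConjectureFor_of_isDiscOneWeilFourfold h5 C hC)

/-- **`Hg(A)` semisimple, `C` CM of discriminant-1 Weil type: `HC(A) ⟹ HC(A × C^(k+1))` — no HC_CM**
(`C^(k+1)` is CM by `isOfCMType_powSucc`; HC(`C^(k+1)`) is Floccari–Fu).
[cite: Gordon1999HodgeAVSurvey, §3 proof of the Theorem (last step)] [cite: FloccariFu2026, Theorem 1.2] -/
theorem hodgeConjectureFor_prod_powSucc_of_semisimple_of_cm_isDiscOneWeilFourfold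
    (h5 : FloccariFu2026_hodgeClasses_algebraic_powers_discOneWeilFourfold)
    (hG : Gordon1999_hodgeClassesProductSpan_of_semisimple) (A C : Motives.AbelianVariety ℂ)
    (hA : HasSemisimpleHodgeGroup A) (hCt : Milne1999.IsOfCMType C) (hC : IsDiscOneWeilFourfold C)
    (hHA : HodgeConjectureFor A.dim A.X) (k : ℕ) :
    HodgeConjectureFor (A.prod (C.powSucc k)).dim (A.prod (C.powSucc k)).X :=
  hodgeConjectureFor_prod_of_productSpan A (C.powSucc k) (hG A _ hA (isOfCMType_powSucc hCt k)) hHA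
    (hodgeConjectureFor_powSucc_of_isDiscOneWeilFourfold h5 C hC k)

/-- **`A` without type-IV factor (Lombardo's hypothesis), `C` CM of discriminant-1 Weil type:
`HC(A) ⟹ HC(A × C)` — no HC_CM.** [cite: Lombardo2016, Lemma 3.4] [cite: FloccariFu2026, Theorem 1.2] -/
theorem hodgeConjectureFor_prod_of_lombardo_of_cm_isDiscOneWeilFourfold
    (h5 : FloccariFu2026_hodgeClasses_algebraic_powers_discOneWeilFourfold)
    (hL : Lombardo2016_hodgeClassesProductSpan) (A C : Motives.AbelianVariety ℂ)
    (hA4 : HasNoTypeIVFactor A) (hCt : Milne1999.IsOfCMType C) (hC : IsDiscOneWeilFourfold C)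
    (hHA : HodgeConjectureFor A.dim A.X) : HodgeConjectureFor (A.prod C).dim (A.prod C).X :=
  hodgeConjectureFor_prod_of_productSpan A C (hL A C hA4 hCt) hHA
    (hodgeConjectureFor_of_isDiscOneWeilFourfold h5 C hC)

/-- **`A` without type-IV factor, `C` CM of discriminant-1 Weil type: `HC(A) ⟹ HC(A × C^(k+1))` — no
HC_CM.** [cite: Lombardo2016, Lemma 3.4] [cite: FloccariFu2026, Theorem 1.2] -/
theorem hodgeConjectureFor_prod_powSucc_of_lombardo_of_cm_isDiscOneWeilFourfold
    (h5 : FloccariFu2026_hodgeClasses_algebraic_powers_discOneWeilFourfold)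
    (hL : Lombardo2016_hodgeClassesProductSpan) (A C : Motives.AbelianVariety ℂ)
    (hA4 : HasNoTypeIVFactor A) (hCt : Milne1999.IsOfCMType C) (hC : IsDiscOneWeilFourfold C)
    (hHA : HodgeConjectureFor A.dim A.X) (k : ℕ) :
    HodgeConjectureFor (A.prod (C.powSucc k)).dim (A.prod (C.powSucc k)).X :=
  hodgeConjectureFor_prod_of_productSpan A (C.powSucc k) (hL A _ hA4 (isOfCMType_powSucc hCt k)) hHA
    (hodgeConjectureFor_powSucc_of_isDiscOneWeilFourfold h5 C hC k)

/-- **CLOSED OUTRIGHT (dimension `≤ 7 + 4k`): `dim A ≤ 3` with `Hg(A)` semisimple, `C` CM of discriminant-1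
Weil type ⟹ HC(`A × C^(k+1)`)** modulo the two facts — HC(`A`) is the tree's unconditional `dim ≤ 3`
theorem; no HC_CM, no claim. (E.g. a threefold with semisimple Hodge group times a simple CM fourfold of
(b)-CM type with `δ = 1`: an atlas cell of dimension 7.)
[cite: Gordon1999HodgeAVSurvey, §3 proof of the Theorem (last step)] [cite: FloccariFu2026, Theorem 1.2] -/
theorem hodgeConjectureFor_prod_powSucc_of_semisimple_of_dim_le_three_of_cm_isDiscOneWeilFourfold
    (h5 : FloccariFu2026_hodgeClasses_algebraic_powers_discOneWeilFourfold)
    (hG : Gordon1999_hodgeClassesProductSpan_of_semisimple) (A C : Motives.AbelianVariety ℂ)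
    (hA : HasSemisimpleHodgeGroup A) (hA3 : A.dim ≤ 3) (hCt : Milne1999.IsOfCMType C)
    (hC : IsDiscOneWeilFourfold C) (k : ℕ) :
    HodgeConjectureFor (A.prod (C.powSucc k)).dim (A.prod (C.powSucc k)).X :=
  hodgeConjectureFor_prod_powSucc_of_semisimple_of_cm_isDiscOneWeilFourfold h5 hG A C hA hCt hC
    (hodgeConjectureFor_of_dim_le_three_holds hA3 Motives.AbelianVariety.isSmoothProjective_holds) k

/-- **CLOSED OUTRIGHT: `dim A ≤ 3` without type-IV factor, `C` CM of discriminant-1 Weil type ⟹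
HC(`A × C^(k+1)`)** modulo Lombardo's splitting fact and Floccari–Fu. [cite: Lombardo2016, Lemma 3.4]
[cite: FloccariFu2026, Theorem 1.2] -/
theorem hodgeConjectureFor_prod_powSucc_of_lombardo_of_dim_le_three_of_cm_isDiscOneWeilFourfold
    (h5 : FloccariFu2026_hodgeClasses_algebraic_powers_discOneWeilFourfold)
    (hL : Lombardo2016_hodgeClassesProductSpan) (A C : Motives.AbelianVariety ℂ)
    (hA4 : HasNoTypeIVFactor A) (hA3 : A.dim ≤ 3) (hCt : Milne1999.IsOfCMType C)
    (hC : IsDiscOneWeilFourfold C) (k : ℕ) :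
    HodgeConjectureFor (A.prod (C.powSucc k)).dim (A.prod (C.powSucc k)).X :=
  hodgeConjectureFor_prod_powSucc_of_lombardo_of_cm_isDiscOneWeilFourfold h5 hL A C hA4 hCt hC
    (hodgeConjectureFor_of_dim_le_three_holds hA3 Motives.AbelianVariety.isSmoothProjective_holds) k

/-- **CLOSED OUTRIGHT (dimension `4(j+1) + 4(k+1)`): a power `A^(j+1)` of a discriminant-1 Weil fourfold with
`Hg(A^(j+1))` semisimple (e.g. the general member, `Hg = SU(2,2)`: the typed link
`HasSemisimpleHodgeGroup_of_hasHodgeGroupSU_statement` of Part III) times a power `C^(k+1)` of a CM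
discriminant-1 Weil fourfold ⟹ HC** modulo the splitting fact and Floccari–Fu (used on BOTH factors).
[cite: Gordon1999HodgeAVSurvey, §3 proof of the Theorem (last step)] [cite: FloccariFu2026, Theorem 1.2] -/
theorem hodgeConjectureFor_powSucc_prod_powSucc_of_isDiscOneWeilFourfold_both
    (h5 : FloccariFu2026_hodgeClasses_algebraic_powers_discOneWeilFourfold)
    (hG : Gordon1999_hodgeClassesProductSpan_of_semisimple) (A C : Motives.AbelianVariety ℂ)
    (hAw : IsDiscOneWeilFourfold A) (j : ℕ) (hAj : HasSemisimpleHodgeGroup (A.powSucc j))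
    (hCt : Milne1999.IsOfCMType C) (hC : IsDiscOneWeilFourfold C) (k : ℕ) :
    HodgeConjectureFor ((A.powSucc j).prod (C.powSucc k)).dim ((A.powSucc j).prod (C.powSucc k)).X :=
  hodgeConjectureFor_prod_powSucc_of_semisimple_of_cm_isDiscOneWeilFourfold h5 hG (A.powSucc j) C hAj hCt
    hC (hodgeConjectureFor_powSucc_of_isDiscOneWeilFourfold h5 A hAw j) k

/-- **Isogeny closure of the product cell** (`X ~ A × C^(k+1)`).
[cite: vanGeemen1994HodgeAV, §3.7 Lemma 3.7 (p. 236)] [cite: FloccariFu2026, Theorem 1.2] -/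
theorem hodgeConjectureFor_of_isIsogenous_prod_powSucc_of_semisimple_of_cm_isDiscOneWeilFourfold
    (h5 : FloccariFu2026_hodgeClasses_algebraic_powers_discOneWeilFourfold)
    (hG : Gordon1999_hodgeClassesProductSpan_of_semisimple) {X : Motives.AbelianVariety ℂ}
    (A C : Motives.AbelianVariety ℂ) (k : ℕ)
    (hX : Motives.AbelianVariety.IsIsogenous X (A.prod (C.powSucc k)))
    (hA : HasSemisimpleHodgeGroup A) (hCt : Milne1999.IsOfCMType C) (hC : IsDiscOneWeilFourfold C)
    (hHA : HodgeConjectureFor A.dim A.X) : HodgeConjectureFor X.dim X.X :=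
  HodgeConjectureFor.of_isIsogenous hX
    (hodgeConjectureFor_prod_powSucc_of_semisimple_of_cm_isDiscOneWeilFourfold h5 hG A C hA hCt hC hHA k)

/-! ### Per-cell exactness: the cell `A × C^(k+1)` is worth exactly HC(`A`) -/

/-- **`HC(A × C^(k+1)) ⟺ HC(A)`** for `Hg(A)` semisimple and `C` CM of discriminant-1 Weil type (modulo the
two facts): (→) restrict to the slice `A × {0}`; (←) the ABSENT row. So on these cells HC_CM is neither
needed nor produced — contrast Part IV's `hodgeConjectureFor_prod_iff_cmHodgeHypothesisAt_of_semisimple`,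
where for a general CM factor the cell is worth the (open) instance of HC_CM at `C`.
[cite: Gordon1999HodgeAVSurvey, §3 proof of the Theorem (last step)] [cite: FloccariFu2026, Theorem 1.2] -/
theorem hodgeConjectureFor_prod_powSucc_iff_left_of_semisimple_of_cm_isDiscOneWeilFourfold
    (h5 : FloccariFu2026_hodgeClasses_algebraic_powers_discOneWeilFourfold)
    (hG : Gordon1999_hodgeClassesProductSpan_of_semisimple) (A C : Motives.AbelianVariety ℂ)
    (hA : HasSemisimpleHodgeGroup A) (hCt : Milne1999.IsOfCMType C) (hC : IsDiscOneWeilFourfold C)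
    (k : ℕ) :
    HodgeConjectureFor (A.prod (C.powSucc k)).dim (A.prod (C.powSucc k)).X ↔
      HodgeConjectureFor A.dim A.X :=
  ⟨hodgeConjectureFor_left_of_prod A (C.powSucc k), fun hHA ↦
    hodgeConjectureFor_prod_powSucc_of_semisimple_of_cm_isDiscOneWeilFourfold h5 hG A C hA hCt hC hHA k⟩

/-- **`HC(A × C) ⟺ HC(A)`**, `A` without type-IV factor, `C` CM of discriminant-1 Weil type (modulo
Lombardo's fact and Floccari–Fu). [cite: Lombardo2016, Lemma 3.4] [cite: FloccariFu2026, Theorem 1.2] -/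
theorem hodgeConjectureFor_prod_iff_left_of_lombardo_of_cm_isDiscOneWeilFourfold
    (h5 : FloccariFu2026_hodgeClasses_algebraic_powers_discOneWeilFourfold)
    (hL : Lombardo2016_hodgeClassesProductSpan) (A C : Motives.AbelianVariety ℂ)
    (hA4 : HasNoTypeIVFactor A) (hCt : Milne1999.IsOfCMType C) (hC : IsDiscOneWeilFourfold C) :
    HodgeConjectureFor (A.prod C).dim (A.prod C).X ↔ HodgeConjectureFor A.dim A.X :=
  ⟨hodgeConjectureFor_left_of_prod A C, fun hHA ↦
    hodgeConjectureFor_prod_of_lombardo_of_cm_isDiscOneWeilFourfold h5 hL A C hA4 hCt hC hHA⟩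

/-! ### On-path lemmas: every target is an instance of the Hodge conjecture -/

/-- **On path**: the Hodge conjecture for all smooth projective complex varieties gives HC for the class,
its powers and the product cells (all conclusions are `HodgeConjectureFor` of an abelian variety).
[cite: Deligne2000, §1] -/
theorem hodgeConjectureFor_prod_powSucc_of_hodgeConjecture
    (h : ∀ ⦃n : ℕ⦄ ⦃X : Motives.SchemeOver ℂ⦄, Motives.IsSmoothProjective n X → HodgeConjectureFor n X)
    (A C : Motives.AbelianVariety ℂ) (k : ℕ) :
    HodgeConjectureFor (A.prod (C.powSucc k)).dim (A.prod (C.powSucc k)).X :=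
  h Motives.AbelianVariety.isSmoothProjective_holds

/-- **On path (the discharged instances)**: the Hodge conjecture gives Milne's hypothesis at every power of
every `C`. [cite: Milne1999, §7 p. 72] -/
theorem cmHodgeHypothesisAt_powSucc_of_hodgeConjecture
    (h : ∀ ⦃n : ℕ⦄ ⦃X : Motives.SchemeOver ℂ⦄, Motives.IsSmoothProjective n X → HodgeConjectureFor n X)
    (C : Motives.AbelianVariety ℂ) (k : ℕ) : Milne1999.CMHodgeHypothesisAt (C.powSucc k) :=
  fun hX _ ↦ h hX

/-- **On path (the class rows)**: the Hodge conjecture gives the right-hand side of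
`floccariFu_iff_forall_isDiscOneWeilFourfold`, hence the Floccari–Fu fact itself (also Part F's
`FloccariFu2026_…_of_hodgeConjectureFor`). [cite: Deligne2000, §1] -/
theorem forall_isDiscOneWeilFourfold_powSucc_of_hodgeConjecture
    (h : ∀ ⦃n : ℕ⦄ ⦃X : Motives.SchemeOver ℂ⦄, Motives.IsSmoothProjective n X → HodgeConjectureFor n X) :
    ∀ C : Motives.AbelianVariety ℂ, IsDiscOneWeilFourfold C →
      ∀ k : ℕ, HodgeConjectureFor (C.powSucc k).dim (C.powSucc k).X :=
  fun _ _ _ ↦ h Motives.AbelianVariety.isSmoothProjective_holds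

end Literature.AlgebraicGeometry.HodgeTheory

end
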